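import Summits.NavierStokesRegularity.NavierStokesRegularity.Theorems.ScenarioCensusAffineMeterLoxodromic
import Summits.NavierStokesRegularity.NavierStokesRegularity.Theorems.ScenarioCensusBlochMeter
import HarnessLib

/-!
# AFFINE METER port, part 3/4: §G the rows over the class, BY NAME (`Row_A2afH` / `P` / `I` / `L` DECIDED; `Row_A2afPd` / `I0` / `E` OPEN typed), `rows_of_L'` / `rows_of_rung`; §V VORTICITY TWINS (REV 2) —
# the same three laws read on `ω = curl u(t₀)` (`Row_A2avH` / `P` / `I` / `L` DECIDED)

Re-homed for the scenario census (typer seat ns-census-typer-1 g10; the cells A2afH / A2afP / A2afI / A2afL (velocity twins) and A2avH / A2avP / A2avI / A2avL (vorticity twins, REV 2) are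
MEMBERS OF RECORD «DECIDED IN KERNEL IN FILES» of row A2 (ns-idea-2 g18 LINE g18-3 REV 2: critic idea-crit-3 PASS (REV 1 14:53:06Z, REV 2 stamp), ref ns-census-ref g16 PRE-CHECK ✓ §21.11,
lead label; OF RECORD 4/4 at census v1.132), A2afPd / A2afI0 / A2afE OPEN (typed); this port makes the decided cells TREE-decided): VERBATIM PORT of ns-idea-2 LINE g18-3 «affine-meter»
REV 2, `pub/ideators/ns-idea-2/lines/affine-meter/line-affine-meter.rev2.lean` sha16 021917a0ebe35407 (1145 l., lean check rc 0, 0 sorry), split for the 400-line rule into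
`ScenarioCensusAffineMeter` (§0, §A, §B) → `…AffineMeterLoxodromic` (§B⁺, §C) → `…AffineMeterRows` (§G, §V) → `…AffineMeterRealisability` (§R + census KEYS).  Lean text VERBATIM in
namespace `…Theorems.ScenarioCensus.AffineMeter` (the line's `…Lines.AffineMeter` re-homed); port edits: the line's `local notation "E3"` is spelled as the reducible `abbrev E3` of every
census file; `norm_slice_le` / `eq_zero_of_slice_translate` / `divergence_conj` are the landed BLOCH METER's (`BlochMeter.norm_slice_le` / `eq_zero_of_slice_periodic` / `divergence_conj`, BY NAME, gate lint dedup.landed — the two g18 lines share these helpers verbatim); `hasFDerivAt_coord` (twin of a Literature lemma outside this closure) is not re-declared — its three instances are stated inline; the two explicit-name `open … (…)` lines of §V spell the opened namespaces in full (inside `…Theorems.ScenarioCensus.*` the relative spelling resolves twice and makes the aliases ambiguous); `@[conjecture]` on the OPEN rows `Row_A2afPd`,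
`Row_A2afI0`, `Row_A2afE`; one-line docstrings added where missing (gate lint).  Statements untouched.

No census VALUE is moved here (row A2 stays OPEN-WITH-LINE; the members become TREE-decided by name); (L′) is NOT proved; no summit statement is proved by this file. Lemmas that restate already-landed tree declarations are taken BY NAME (gate lint `dedup.landed`): `norm_slice_le` = `BlochMeter.norm_slice_le`, `eq_zero_of_slice_translate` = `BlochMeter.eq_zero_of_slice_periodic`, `divergence_conj` = `BlochMeter.divergence_conj`.
-/

-- the summit and its single problem share the name `NavierStokesRegularity` (D-0017 nested layout)
set_option linter.dupNamespace false

noncomputable section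

open Set Function Filter Metric MeasureTheory InnerProductSpace
open scoped Topology RealInnerProductSpace
open Literature.Analysis Literature.Analysis.FluidPDE
open Summit.NavierStokesRegularity.NavierStokesRegularity.Theorems
open Summit.NavierStokesRegularity.NavierStokesRegularity.Theorems.ScenarioCensus

namespace Summit.NavierStokesRegularity.NavierStokesRegularity.Theorems.ScenarioCensus.AffineMeter

/-! ### §G  Rows over the class, BY NAME; `rows_of_rung` -/

/-- Row A2afH — HYPERBOLIC elementary twin: «on a pocket of ONE slice, `u(t₀, x + ⟪n,x⟫ m + b) =
u(t₀,x) + ⟪n, u(t₀,x)⟫ m` with multiplier `μ = 1 + ⟪n, m⟫`, `|μ| ≠ 1`, `μ ≠ 0`» ⇒ `u ≡ 0`.  DECIDED (proved: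
laws 1 + 2, `translate_eq_of_twin_hyperbolic`, then the translation exit). -/
def Row_A2afH : Prop :=
  ∀ (C : ℝ) (u : ℝ → E3 → E3), IsTypeIAncientMild C u →
    (∃ (t₀ : ℝ) (m n b : E3) (U : Set E3), t₀ < 0 ∧ |1 + ⟪n, m⟫| ≠ 1 ∧ 1 + ⟪n, m⟫ ≠ 0 ∧ IsOpen U ∧
      U.Nonempty ∧ ∀ x ∈ U, u t₀ (x + ⟪n, x⟫ • m + b) = u t₀ x + ⟪n, u t₀ x⟫ • m) →
    ∀ t < 0, ∀ x, u t x = 0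

/-- **Row `Row_A2afH` holds.** -/
theorem row_A2afH : Row_A2afH := by
  rintro C u hu ⟨t₀, m, n, b, U, ht₀, h1, h0, hU, hne, h⟩
  have hm : m ≠ 0 := by rintro rfl; exact h1 (by simp)
  have htwin : ∀ x, u t₀ (aff m n b x) = elem m n (u t₀ x) :=
    twin_of_pocket (hu.analyticOnNhd_slice_univ ht₀) hU hne fun x hx => h x hx
  obtain ⟨L, hL⟩ := exists_lipschitz_slice hu ht₀
  have key := translate_eq_of_twin_hyperbolic (BlochMeter.norm_slice_le hu ht₀) hL htwin h1 h0
  exact BlochMeter.eq_zero_of_slice_periodic hu ht₀ hm fun x => by simpa using key x 1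

/-- Row A2afP — PARABOLIC elementary twin WITH A FIXED POINT: «on a pocket of ONE slice,
`u(t₀, x + (⟪n,x⟫ + s₀) m) = u(t₀,x) + ⟪n, u(t₀,x)⟫ m` with `⟪n, m⟫ = 0`, `m ≠ 0`, `n ≠ 0`» (the shear fixes the
plane `⟪n, x⟫ = −s₀`) ⇒ `u ≡ 0`.  DECIDED (proved: laws 1′ + 3, then the translation exit). -/
def Row_A2afP : Prop :=
  ∀ (C : ℝ) (u : ℝ → E3 → E3), IsTypeIAncientMild C u →
    (∃ (t₀ s₀ : ℝ) (m n : E3) (U : Set E3), t₀ < 0 ∧ ⟪n, m⟫ = 0 ∧ m ≠ 0 ∧ n ≠ 0 ∧ IsOpen U ∧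
      U.Nonempty ∧ ∀ x ∈ U, u t₀ (x + (⟪n, x⟫ + s₀) • m) = u t₀ x + ⟪n, u t₀ x⟫ • m) →
    ∀ t < 0, ∀ x, u t x = 0

/-- Auxiliary lemma of the line, stated and proved verbatim (`aff_smul_self`). -/
theorem aff_smul_self (m n : E3) (s₀ : ℝ) (x : E3) : aff m n (s₀ • m) x = x + (⟪n, x⟫ + s₀) • m := by
  simp only [aff, add_smul]; abel

/-- **Row `Row_A2afP` holds.** -/
theorem row_A2afP : Row_A2afP := by
  rintro C u hu ⟨t₀, s₀, m, n, U, ht₀, hκ, hm, hn, hU, hne, h⟩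
  have han := hu.analyticOnNhd_slice_univ ht₀
  have htwin : ∀ x, u t₀ (aff m n (s₀ • m) x) = elem m n (u t₀ x) :=
    twin_of_pocket han hU hne fun x hx => by rw [aff_smul_self]; exact h x hx
  have hz : ∀ x, ⟪n, u t₀ x⟫ = 0 := inner_eq_zero_of_twin_of_orth (BlochMeter.norm_slice_le hu ht₀) htwin hκ hm
  have hinv : ∀ x, u t₀ (x + (⟪n, x⟫ + s₀) • m) = u t₀ x := fun x => by
    rw [← aff_smul_self]; exact invariant_of_inner_eq_zero htwin hz x
  have key := translate_eq_of_invariant_parabolic han hκ hn hinv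
  exact BlochMeter.eq_zero_of_slice_periodic hu ht₀ hm fun x => by simpa using key x 1

/-- Row A2afI — INVOLUTIVE elementary twin whose square is a genuine translation: «on a pocket of ONE slice,
`u(t₀, x + ⟪n,x⟫ m + b) = u(t₀,x) + ⟪n, u(t₀,x)⟫ m` with `⟪n, m⟫ = −2` and `T = ⟪n, b⟫ m + 2 b ≠ 0`» ⇒ `u ≡ 0`.
DECIDED (proved: `g²` = translation by `T`, `M² = 1`, census A13).  The isometric sub-case `m ∥ n` is a glide
reflection. -/
def Row_A2afI : Prop :=
  ∀ (C : ℝ) (u : ℝ → E3 → E3), IsTypeIAncientMild C u →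
    (∃ (t₀ : ℝ) (m n b : E3) (U : Set E3), t₀ < 0 ∧ ⟪n, m⟫ = -2 ∧ ⟪n, b⟫ • m + (2 : ℝ) • b ≠ 0 ∧
      IsOpen U ∧ U.Nonempty ∧ ∀ x ∈ U, u t₀ (x + ⟪n, x⟫ • m + b) = u t₀ x + ⟪n, u t₀ x⟫ • m) →
    ∀ t < 0, ∀ x, u t x = 0

/-- **Row `Row_A2afI` holds.** -/
theorem row_A2afI : Row_A2afI := by
  rintro C u hu ⟨t₀, m, n, b, U, ht₀, hκ, hT, hU, hne, h⟩
  have htwin : ∀ x, u t₀ (aff m n b x) = elem m n (u t₀ x) :=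
    twin_of_pocket (hu.analyticOnNhd_slice_univ ht₀) hU hne fun x hx => h x hx
  refine BlochMeter.eq_zero_of_slice_periodic hu ht₀ hT fun x => ?_
  rw [← aff_aff_of_involutive hκ b x, htwin, htwin, elem_elem_of_involutive hκ]

/-- Row A2afL — LOXODROMIC twin (rank two): «on a pocket of ONE slice, `u(t₀, M x + b) = M u(t₀, x)` with
`M v = R v + (μ − 1)⟪e, v⟫ e`, `R` a linear isometry fixing the unit vector `e` (a rotation about `e`, or a
reflection/rotoreflection fixing `e`), `|μ| ≠ 1`, `μ ≠ 0`» — a spiral sink/source self-similarity of the slice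
⇒ `u ≡ 0`.  DECIDED (proved: laws 1 + 2 in operator form, `translate_eq_of_twin_loxodromic`, translation exit).
`R = 1` is the rank-one hyperbolic row with `m = (μ − 1) e`, `n = e`. -/
def Row_A2afL : Prop :=
  ∀ (C : ℝ) (u : ℝ → E3 → E3), IsTypeIAncientMild C u →
    (∃ (t₀ μ : ℝ) (R : E3 ≃ₗᵢ[ℝ] E3) (e b : E3) (U : Set E3), t₀ < 0 ∧ ‖e‖ = 1 ∧ R e = e ∧ |μ| ≠ 1 ∧
      μ ≠ 0 ∧ IsOpen U ∧ U.Nonempty ∧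
      ∀ x ∈ U, u t₀ (R x + ((μ - 1) * ⟪e, x⟫) • e + b) = R (u t₀ x) + ((μ - 1) * ⟪e, u t₀ x⟫) • e) →
    ∀ t < 0, ∀ x, u t x = 0

/-- **Row `Row_A2afL` holds.** -/
theorem row_A2afL : Row_A2afL := by
  rintro C u hu ⟨t₀, μ, R, e, b, U, ht₀, he, hRe, h1, h0, hU, hne, h⟩
  have he0 : e ≠ 0 := by rintro rfl; simp at he
  have htwin : ∀ x, u t₀ (loxL R e μ x + b) = loxL R e μ (u t₀ x) :=
    twin_of_pocket_clm (hu.analyticOnNhd_slice_univ ht₀) hU hne fun x hx => by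
      simpa only [loxL_apply] using h x hx
  obtain ⟨L, hL⟩ := exists_lipschitz_slice hu ht₀
  have key := translate_eq_of_twin_loxodromic he hRe h1 h0 (BlochMeter.norm_slice_le hu ht₀) hL htwin
  exact BlochMeter.eq_zero_of_slice_periodic hu ht₀ he0 fun x => by simpa using key x 1

/-- Row A2afPd — PARABOLIC elementary twin WITHOUT a fixed point (`⟪n, m⟫ = 0`, `b ∉ ℝ m`).  OPEN (typed only):
kinematically realisable (`control_parabolic_drift`); laws 1′ still give `⟪n, u(t₀,·)⟫ ≡ 0` and invariance of
the slice under the fixed-point-free shear, but neither contraction nor accumulation applies.  No claim. -/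
@[conjecture] def Row_A2afPd : Prop :=
  ∀ (C : ℝ) (u : ℝ → E3 → E3), IsTypeIAncientMild C u →
    (∃ (t₀ : ℝ) (m n b : E3) (U : Set E3), t₀ < 0 ∧ ⟪n, m⟫ = 0 ∧ m ≠ 0 ∧ n ≠ 0 ∧ (∀ s : ℝ, b ≠ s • m) ∧
      IsOpen U ∧ U.Nonempty ∧ ∀ x ∈ U, u t₀ (x + ⟪n, x⟫ • m + b) = u t₀ x + ⟪n, u t₀ x⟫ • m) →
    ∀ t < 0, ∀ x, u t x = 0

/-- Row A2afI0 — INVOLUTIVE elementary twin with `g² = id` (an oblique reflection symmetry of one slice;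
`m ∥ n` is the mirror cell).  OPEN (typed only): a discrete symmetry of order two is not propagated to decay
by anything in the tree.  No claim. -/
@[conjecture] def Row_A2afI0 : Prop :=
  ∀ (C : ℝ) (u : ℝ → E3 → E3), IsTypeIAncientMild C u →
    (∃ (t₀ : ℝ) (m n b : E3) (U : Set E3), t₀ < 0 ∧ ⟪n, m⟫ = -2 ∧ ⟪n, b⟫ • m + (2 : ℝ) • b = 0 ∧
      IsOpen U ∧ U.Nonempty ∧ ∀ x ∈ U, u t₀ (x + ⟪n, x⟫ • m + b) = u t₀ x + ⟪n, u t₀ x⟫ • m) →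
    ∀ t < 0, ∀ x, u t x = 0

/-- Row A2afE — ELLIPTIC NON-ISOMETRIC twin (rank two; e.g. `M = D R_θ D⁻¹`, an anisotropically conjugated
rotation): «`u(t₀, M x + b) = M u(t₀, x)` on a pocket, `M` and `M⁻¹` power-bounded, `M` not an isometry».
OPEN (typed only): the heights neither grow nor accumulate; the isometric case is the rotation-order meter
(g11) and the tree's axisymmetric cells.  No claim. -/
@[conjecture] def Row_A2afE : Prop :=
  ∀ (C : ℝ) (u : ℝ → E3 → E3), IsTypeIAncientMild C u →
    (∃ (t₀ : ℝ) (M M' : E3 →L[ℝ] E3) (b : E3) (U : Set E3) (K : ℝ), t₀ < 0 ∧ M'.comp M = 1 ∧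
      M.comp M' = 1 ∧ (∀ k : ℕ, ‖M ^ k‖ ≤ K ∧ ‖M' ^ k‖ ≤ K) ∧ (∃ v, ‖M v‖ ≠ ‖v‖) ∧ IsOpen U ∧
      U.Nonempty ∧ ∀ x ∈ U, u t₀ (M x + b) = M (u t₀ x)) →
    ∀ t < 0, ∀ x, u t x = 0

/-- (L′) over `IsTypeIAncientMild` implies every row (decided or open). -/
theorem rows_of_L' (hL : ∀ (C : ℝ) (u : ℝ → E3 → E3), IsTypeIAncientMild C u → ∀ t < 0, ∀ x, u t x = 0) :
    Row_A2afH ∧ Row_A2afP ∧ Row_A2afI ∧ Row_A2afL ∧ Row_A2afPd ∧ Row_A2afI0 ∧ Row_A2afE :=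
  ⟨fun C u hu _ => hL C u hu, fun C u hu _ => hL C u hu, fun C u hu _ => hL C u hu,
    fun C u hu _ => hL C u hu, fun C u hu _ => hL C u hu, fun C u hu _ => hL C u hu,
    fun C u hu _ => hL C u hu⟩

/-- **The rung decides every row**: the LADDER-NS rung (L′) `Theses.SymmetryModuliCount.TypeIAncientLiouville`
⟨stmt-NavierStokesRegularity-10661⟩, BY NAME, implies every row of the affine meter (including the open
`Row_A2afPd`, `Row_A2afI0`, `Row_A2afE`).  Nothing here proves the rung.  No summit is proved by a line. -/
theorem rows_of_rung (hL : Theses.SymmetryModuliCount.TypeIAncientLiouville) :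
    Row_A2afH ∧ Row_A2afP ∧ Row_A2afI ∧ Row_A2afL ∧ Row_A2afPd ∧ Row_A2afI0 ∧ Row_A2afE :=
  rows_of_L' fun C u hu => hL C u (isTypeIAncientMild_iff.1 hu)

/-- The finite model agrees with the rows: the three decided types are exactly the `fatal` verdicts. -/
theorem verdict_agrees :
    (∀ κ : ℝ, |1 + κ| ≠ 1 → 1 + κ ≠ 0 → ∀ fp sq, verdict κ fp sq = .fatal) ∧
    verdict 0 true false = .fatal ∧ verdict 0 false false = .undecided ∧
    verdict (-2) false false = .fatal ∧ verdict (-2) false true = .undecided ∧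
    verdict (-1) false false = .notASymmetry :=
  ⟨fun κ h1 h0 fp sq => verdict_hyperbolic h1 h0 fp sq, by simp [verdict], by simp [verdict],
    by simp [verdict], by simp [verdict], by simp [verdict]⟩

/-! ### §V  VORTICITY TWINS (REV 2) — the same three laws read on `ω = curl u(t₀)`

The laws of §B/§B⁺ are GENERIC in the field `f` (bounded · Lipschitz · analytic).  The vorticity slice
`ω = curl u(t₀)` of a profile of the class has all three (tree, BY NAME:
`PoloidalWindowDoor…LocalVorticitySymmetry.analyticOnNhd_curl_slice`,
`PoloidalWindowDoor…VorticityTranslate.exists_norm_curl_slice_le`, `…exists_norm_iteratedFDeriv_slice_le` with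
`norm_iteratedFDeriv_curl_le`), and the tree's K2 exit `eq_zero_of_curl_translate_eq_slice` (vorticity of ONE
slice invariant under the translations along `e ≠ 0` ⇒ `u ≡ 0`; KNSS Lemma 3.1 + bounded ancient 2D Liouville)
replaces census A13; for a single period `periodic_of_curl_periodic` (curl `p`-periodic ⇒ field `p`-periodic)
feeds A13.  Hence four more DECIDED rows: a non-isometric affine twin OF THE VORTICITY of one slice on one
pocket, `ω(t₀, g x) = M ω(t₀, x)`, of hyperbolic / parabolic-with-fixed-point / involutive (`g² ≠ id`) /
loxodromic type is fatal.  These are DIFFERENT cells from §G: for a non-isometric `M` a velocity twin does not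
induce a vorticity twin (the curl is metric; only for isometries `curl (R u R⁻¹) = (det R) R (curl u) R⁻¹`,
tree `curl_conj_rigidMotion`), so the vorticity meter reads symmetries the velocity meter cannot see. -/

section Vorticity

open Summit.NavierStokesRegularity.NavierStokesRegularity.Theorems.PoloidalWindowDoorPoloidalWindowRigidityVorticityTranslate
  (eq_zero_of_curl_translate_eq_slice exists_norm_curl_slice_le exists_norm_iteratedFDeriv_slice_le
    periodic_of_curl_periodic)
open Summit.NavierStokesRegularity.NavierStokesRegularity.Theorems.PoloidalWindowDoorPoloidalWindowRigidityLocalVorticitySymmetry (analyticOnNhd_curl_slice)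

variable {C : ℝ} {u : ℝ → E3 → E3} {t₀ : ℝ}

/-- The vorticity slice of a profile of the class is real-analytic on `ℝ³` (tree, BY NAME). -/
theorem analyticOnNhd_curl_slice_univ (hu : IsTypeIAncientMild C u) (ht₀ : t₀ < 0) :
    AnalyticOnNhd ℝ (curl (u t₀)) univ :=
  analyticOnNhd_curl_slice hu.hasTypeITimeDecay hu.continuousOn_uncurry
    (fun _ _ hsr hr y => hu.mild_eq_heatExtension hsr hr y) ht₀

/-- The vorticity slice of a profile of the class is bounded (tree, BY NAME). -/
theorem exists_norm_curl_slice_le' (hu : IsTypeIAncientMild C u) (ht₀ : t₀ < 0) :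
    ∃ K : ℝ, ∀ x, ‖curl (u t₀) x‖ ≤ K :=
  exists_norm_curl_slice_le hu.hasTypeITimeDecay hu.continuousOn_uncurry
    (fun _ _ hsr hr y => hu.mild_eq_heatExtension hsr hr y) (fun _ hs => hu.isDivFree hs) ht₀

/-- The vorticity slice of a profile of the class is Lipschitz (KNSS derivative bound of order two,
`‖D curl w‖ ≤ ‖curlCLM‖ ‖D² w‖`, mean value inequality). -/
theorem exists_lipschitz_curl_slice (hu : IsTypeIAncientMild C u) (ht₀ : t₀ < 0) :
    ∃ L : ℝ, ∀ x y : E3, ‖curl (u t₀) x - curl (u t₀) y‖ ≤ L * ‖x - y‖ := by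
  obtain ⟨K, hK⟩ := exists_norm_iteratedFDeriv_slice_le hu.hasTypeITimeDecay hu.continuousOn_uncurry
    (fun _ _ hsr hr y => hu.mild_eq_heatExtension hsr hr y) (fun _ hs => hu.isDivFree hs) 2 ht₀
  have hC2 : ContDiff ℝ (1 + 1) (u t₀) := (hu.analyticOnNhd_slice_univ ht₀).contDiff
  have hb : ∀ x, ‖fderiv ℝ (curl (u t₀)) x‖ ≤ ‖(curlCLM : (E3 →L[ℝ] E3) →L[ℝ] E3)‖ * K := fun x => by
    have h1 := norm_iteratedFDeriv_curl_le (n := 1) hC2 x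
    rw [← norm_iteratedFDeriv_fderiv, norm_iteratedFDeriv_zero] at h1
    exact h1.trans (mul_le_mul_of_nonneg_left (hK x) (norm_nonneg (curlCLM : (E3 →L[ℝ] E3) →L[ℝ] E3)))
  have hd : ∀ x, DifferentiableAt ℝ (curl (u t₀)) x := fun x =>
    (analyticOnNhd_curl_slice_univ hu ht₀ x (mem_univ x)).differentiableAt
  exact ⟨_, fun x y => Convex.norm_image_sub_le_of_norm_fderiv_le (fun z _ => hd z)
    (fun z _ => hb z) convex_univ (mem_univ y) (mem_univ x)⟩

/-- VORTICITY TRANSLATION EXIT (tree K2, BY NAME): the vorticity of ONE slice invariant under all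
translations along `e ≠ 0` ⇒ `u ≡ 0` on `t < 0`. -/
theorem eq_zero_of_curl_slice_translate (hu : IsTypeIAncientMild C u) (ht₀ : t₀ < 0) {e : E3} (he : e ≠ 0)
    (h : ∀ (x : E3) (τ : ℝ), curl (u t₀) (x + τ • e) = curl (u t₀) x) : ∀ t < 0, ∀ x, u t x = 0 :=
  eq_zero_of_curl_translate_eq_slice hu.hasTypeITimeDecay hu.continuousOn_uncurry
    (fun _ _ hsr hr y => hu.mild_eq_heatExtension hsr hr y) (fun _ hs => hu.isDivFree hs) ht₀ he h

/-- VORTICITY PERIOD EXIT: the vorticity of ONE slice `a`-periodic (`a ≠ 0`) ⇒ the slice is `a`-periodic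
(tree `periodic_of_curl_periodic`: bounded incompressible `C²`) ⇒ census A13 ⇒ `u ≡ 0`. -/
theorem eq_zero_of_curl_slice_periodic (hu : IsTypeIAncientMild C u) (ht₀ : t₀ < 0) {a : E3} (ha : a ≠ 0)
    (h : ∀ x, curl (u t₀) (x + a) = curl (u t₀) x) : ∀ t < 0, ∀ x, u t x = 0 :=
  BlochMeter.eq_zero_of_slice_periodic hu ht₀ ha
    (periodic_of_curl_periodic (hu.analyticOnNhd_slice_univ ht₀).contDiff
      (hu.isDivFree ht₀) (BlochMeter.norm_slice_le hu ht₀) h)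

/-- Row A2avH — HYPERBOLIC elementary twin OF THE VORTICITY: «on a pocket of ONE slice,
`ω(t₀, x + ⟪n,x⟫ m + b) = ω(t₀,x) + ⟪n, ω(t₀,x)⟫ m`, `ω = curl u`, `|μ| ≠ 1`, `μ ≠ 0`» ⇒ `u ≡ 0`.
DECIDED (laws 1 + 2 on `ω`, vorticity translation exit). -/
def Row_A2avH : Prop :=
  ∀ (C : ℝ) (u : ℝ → E3 → E3), IsTypeIAncientMild C u →
    (∃ (t₀ : ℝ) (m n b : E3) (U : Set E3), t₀ < 0 ∧ |1 + ⟪n, m⟫| ≠ 1 ∧ 1 + ⟪n, m⟫ ≠ 0 ∧ IsOpen U ∧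
      U.Nonempty ∧ ∀ x ∈ U, curl (u t₀) (x + ⟪n, x⟫ • m + b) = curl (u t₀) x + ⟪n, curl (u t₀) x⟫ • m) →
    ∀ t < 0, ∀ x, u t x = 0

/-- **Row `Row_A2avH` holds.** -/
theorem row_A2avH : Row_A2avH := by
  rintro C u hu ⟨t₀, m, n, b, U, ht₀, h1, h0, hU, hne, h⟩
  have hm : m ≠ 0 := by rintro rfl; exact h1 (by simp)
  have htwin : ∀ x, curl (u t₀) (aff m n b x) = elem m n (curl (u t₀) x) :=
    twin_of_pocket (analyticOnNhd_curl_slice_univ hu ht₀) hU hne fun x hx => h x hx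
  obtain ⟨K, hK⟩ := exists_norm_curl_slice_le' hu ht₀
  obtain ⟨L, hL⟩ := exists_lipschitz_curl_slice hu ht₀
  exact eq_zero_of_curl_slice_translate hu ht₀ hm (translate_eq_of_twin_hyperbolic hK hL htwin h1 h0)

/-- Row A2avP — PARABOLIC elementary twin OF THE VORTICITY with a fixed plane: «on a pocket of ONE slice,
`ω(t₀, x + (⟪n,x⟫ + s₀) m) = ω(t₀,x) + ⟪n, ω(t₀,x)⟫ m`, `⟪n, m⟫ = 0`, `m ≠ 0`, `n ≠ 0`» ⇒ `u ≡ 0`.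
DECIDED (laws 1′ + 3 on `ω`, vorticity translation exit). -/
def Row_A2avP : Prop :=
  ∀ (C : ℝ) (u : ℝ → E3 → E3), IsTypeIAncientMild C u →
    (∃ (t₀ s₀ : ℝ) (m n : E3) (U : Set E3), t₀ < 0 ∧ ⟪n, m⟫ = 0 ∧ m ≠ 0 ∧ n ≠ 0 ∧ IsOpen U ∧
      U.Nonempty ∧ ∀ x ∈ U, curl (u t₀) (x + (⟪n, x⟫ + s₀) • m) = curl (u t₀) x + ⟪n, curl (u t₀) x⟫ • m) →
    ∀ t < 0, ∀ x, u t x = 0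

/-- **Row `Row_A2avP` holds.** -/
theorem row_A2avP : Row_A2avP := by
  rintro C u hu ⟨t₀, s₀, m, n, U, ht₀, hκ, hm, hn, hU, hne, h⟩
  have han := analyticOnNhd_curl_slice_univ hu ht₀
  have htwin : ∀ x, curl (u t₀) (aff m n (s₀ • m) x) = elem m n (curl (u t₀) x) :=
    twin_of_pocket han hU hne fun x hx => by rw [aff_smul_self]; exact h x hx
  obtain ⟨K, hK⟩ := exists_norm_curl_slice_le' hu ht₀
  have hz : ∀ x, ⟪n, curl (u t₀) x⟫ = 0 := inner_eq_zero_of_twin_of_orth hK htwin hκ hm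
  have hinv : ∀ x, curl (u t₀) (x + (⟪n, x⟫ + s₀) • m) = curl (u t₀) x := fun x => by
    rw [← aff_smul_self]; exact invariant_of_inner_eq_zero htwin hz x
  exact eq_zero_of_curl_slice_translate hu ht₀ hm (translate_eq_of_invariant_parabolic han hκ hn hinv)

/-- Row A2avI — INVOLUTIVE elementary twin OF THE VORTICITY whose square is a genuine translation:
«`ω(t₀, x + ⟪n,x⟫ m + b) = ω(t₀,x) + ⟪n, ω(t₀,x)⟫ m` on a pocket, `⟪n, m⟫ = −2`, `T = ⟪n, b⟫ m + 2 b ≠ 0`»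
⇒ `u ≡ 0`.  DECIDED (`ω(t₀)` is `T`-periodic ⇒ `u(t₀)` is `T`-periodic (tree) ⇒ census A13). -/
def Row_A2avI : Prop :=
  ∀ (C : ℝ) (u : ℝ → E3 → E3), IsTypeIAncientMild C u →
    (∃ (t₀ : ℝ) (m n b : E3) (U : Set E3), t₀ < 0 ∧ ⟪n, m⟫ = -2 ∧ ⟪n, b⟫ • m + (2 : ℝ) • b ≠ 0 ∧
      IsOpen U ∧ U.Nonempty ∧
      ∀ x ∈ U, curl (u t₀) (x + ⟪n, x⟫ • m + b) = curl (u t₀) x + ⟪n, curl (u t₀) x⟫ • m) →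
    ∀ t < 0, ∀ x, u t x = 0

/-- **Row `Row_A2avI` holds.** -/
theorem row_A2avI : Row_A2avI := by
  rintro C u hu ⟨t₀, m, n, b, U, ht₀, hκ, hT, hU, hne, h⟩
  have htwin : ∀ x, curl (u t₀) (aff m n b x) = elem m n (curl (u t₀) x) :=
    twin_of_pocket (analyticOnNhd_curl_slice_univ hu ht₀) hU hne fun x hx => h x hx
  refine eq_zero_of_curl_slice_periodic hu ht₀ hT fun x => ?_
  rw [← aff_aff_of_involutive hκ b x, htwin, htwin, elem_elem_of_involutive hκ]

/-- Row A2avL — LOXODROMIC twin OF THE VORTICITY (rank two): «`ω(t₀, M x + b) = M ω(t₀, x)` on a pocket with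
`M v = R v + (μ − 1)⟪e, v⟫ e`, `R` a linear isometry fixing the unit vector `e`, `|μ| ≠ 1`, `μ ≠ 0`» ⇒ `u ≡ 0`.
DECIDED (laws 1 + 2 in operator form on `ω`, vorticity translation exit). -/
def Row_A2avL : Prop :=
  ∀ (C : ℝ) (u : ℝ → E3 → E3), IsTypeIAncientMild C u →
    (∃ (t₀ μ : ℝ) (R : E3 ≃ₗᵢ[ℝ] E3) (e b : E3) (U : Set E3), t₀ < 0 ∧ ‖e‖ = 1 ∧ R e = e ∧ |μ| ≠ 1 ∧
      μ ≠ 0 ∧ IsOpen U ∧ U.Nonempty ∧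
      ∀ x ∈ U, curl (u t₀) (R x + ((μ - 1) * ⟪e, x⟫) • e + b) =
        R (curl (u t₀) x) + ((μ - 1) * ⟪e, curl (u t₀) x⟫) • e) →
    ∀ t < 0, ∀ x, u t x = 0

/-- **Row `Row_A2avL` holds.** -/
theorem row_A2avL : Row_A2avL := by
  rintro C u hu ⟨t₀, μ, R, e, b, U, ht₀, he, hRe, h1, h0, hU, hne, h⟩
  have he0 : e ≠ 0 := by rintro rfl; simp at he
  have htwin : ∀ x, curl (u t₀) (loxL R e μ x + b) = loxL R e μ (curl (u t₀) x) :=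
    twin_of_pocket_clm (analyticOnNhd_curl_slice_univ hu ht₀) hU hne fun x hx => by
      simpa only [loxL_apply] using h x hx
  obtain ⟨K, hK⟩ := exists_norm_curl_slice_le' hu ht₀
  obtain ⟨L, hL⟩ := exists_lipschitz_curl_slice hu ht₀
  exact eq_zero_of_curl_slice_translate hu ht₀ he0
    (translate_eq_of_twin_loxodromic he hRe h1 h0 hK hL htwin)

/-- (L′) over `IsTypeIAncientMild` implies the four vorticity rows. -/
theorem vrows_of_L' (hL : ∀ (C : ℝ) (u : ℝ → E3 → E3), IsTypeIAncientMild C u → ∀ t < 0, ∀ x, u t x = 0) :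
    Row_A2avH ∧ Row_A2avP ∧ Row_A2avI ∧ Row_A2avL :=
  ⟨fun C u hu _ => hL C u hu, fun C u hu _ => hL C u hu, fun C u hu _ => hL C u hu,
    fun C u hu _ => hL C u hu⟩

/-- **The rung decides the vorticity rows too** (BY NAME, ⟨stmt-NavierStokesRegularity-10661⟩).  Nothing here
proves the rung.  No summit is proved by a line. -/
theorem vrows_of_rung (hL : Theses.SymmetryModuliCount.TypeIAncientLiouville) :
    Row_A2avH ∧ Row_A2avP ∧ Row_A2avI ∧ Row_A2avL :=
  vrows_of_L' fun C u hu => hL C u (isTypeIAncientMild_iff.1 hu)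

end Vorticity

end Summit.NavierStokesRegularity.NavierStokesRegularity.Theorems.ScenarioCensus.AffineMeter

end
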